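import Summits.BirchSwinnertonDyer.Rank1Residual.X11a.PrintDischarge
import Summits.BirchSwinnertonDyer.Rank1Residual.Additive.X4RankZeroVisibleLowerHalfSockets
import Literature.NumberTheory.EllipticCurves.Rank1Residual.Typed.VisibilityCertificateMultiplicative
import HarnessLib

/-!
# Class X11a: the VISIBILITY door BY NAME on the leaf — per-pair lower half
# `ord_p #Ш_an ≤ ord_p #Ш` from a rank-2 `p`-congruent partner, and `BSD(E,p)` on the surjective leaf
# (cell `bsd-print-x11a`, seat p4 «level-lowering + visibility certificate road»)

HONEST FRAMING (cells `b2b-bsdres` / `bsd-print-x11a`, verbatim): the goal is to DELETE the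
COMBINATION-SHAPED residual classes of the Birch–Swinnerton-Dyer formula for ALL analytic-rank
`≤ 1` elliptic curves over `ℚ` — "full BSD formula for every rank `≤ 1` curve in class `C`"
assembled STRICTLY from published theorems — so that the rank-`≤ 1` remainder becomes exactly the
CONSTRUCTION-SHAPED classes, which are TYPED (missing-input `Prop`s), NOT attempted. This is not
"finishing BSD". Research route; NO CLAIM BEYOND STATED CLASSES. THEOREMS ONLY (no definition, no
named fact); every published input is an explicit NAMED-FACT hypothesis; PER PAIR doors, NOT class
theorems; nothing is booked by this file and no class label changes (referee / planner).

## What and why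

Row X11a of the partition (`ClassX11a W p := r_an = 0 ∧ p ≠ 2 ∧ Mult W p ∧ Irr W p ∧ ¬ Ram W p`,
`Partition/Rows.lean`; statement of record `X11a.Target`, sub-cells `CellThree / CellPub / Leaf`,
`X11a/Cells.lean`). The class-level lower half — `ClassX11a W p → MissingLowerBoundAt W p`, crux
`ErratumRoadFive.X11aLowerHalf` of the BSD ladder — is OPEN (a (ram)-free integral cyclotomic main
conjecture at `p ∥ N`; end state `X11a.target_of_endState`). The visibility road
(Cremona–Mazur 2000 §3 / Agashe–Stein 2002 Thm. 3.1; kernel count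
`WeierstrassCurve.exists_sha_ne_zero_of_congr_of_index_lt`, valid at `p ∣ N`) CANNOT supply it as a
class theorem — the existence of a rank-`≥ 2` `p`-congruent partner is a per-curve accident — but it
supplies it PER PAIR, from published theorems plus a finite certificate. This file states those
per-pair doors ON THE CLASS, BY NAME, in the two currencies the ledger reads:

* §1 `ClassX11a.missingLowerBoundAt_of_congr_of_rank_two[_of_primeList]` — the LOWER half
  `MissingLowerBoundAt W p` (the crux's currency) at an X11a pair with `ord_p #Ш_an ≤ 2`, from a
  `Γ_ℚ`-isomorphism `θ : E'[p] ≃ E[p]` out of a curve `E'` of Mordell–Weil rank `≥ 2` with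
  `E'(ℚ_v)[p] = 0` at the places of `S` (resp. over a prime list `L ∋ p` supporting both integral
  discriminants); NO image hypothesis beyond the class's `Irr` (so it serves the non-surjective leaf
  `5S4 / 5Ns / 7Ns` too). Named facts: Cassels–Tate (`hCT`), Gross–Zagier–Kolyvagin (`hGZK`). By
  name: the additive team's class-free socket `Additive.RankZero.missingLowerBoundAt_of_congr_of_rank_two`.
* §2 `Leaf.bsdp_of_congr_of_rank_two_of_surj`, `ClassX11a.bsdp_of_congr_of_places_of_surj`,
  `ClassX11a.bsdp_of_congr_of_rank_two_of_primeList_of_surj` — `BSD(E,p)` on the SURJECTIVE leaf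
  (upper half: Wuthrich 2014 Prop. 21, `hW`; modularity `hmod`), crude (by name the cell's discharge
  interface `X11a.bsdp_of_congr_of_rank_two`, `X11a/PrintDischarge.lean`, itself x11a gen 9's
  `X11RankZero.bsdp_of_congr_of_rank_two`), refined (pay at `T`, free kinds elsewhere; Tate
  uniformisation `hU`, `hU2`; `Typed.bsdp_of_wuthrich_of_congr_of_places_of_surj`, gen 10) and
  prime-list counts.

Per-pair DISPLAYED binders (certified outside the kernel, two engines, referee-sampled): `θ`/`hθ`
(Sturm / Kraus–Oesterlé bound congruence of two newforms + irreducibility), `hrank` (two explicit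
independent points), the local binders at the places of `S` (kernel deciders exist at many places:
`GaloisImage/LocalTorsionAwayFromPAdicCompletion`, `…/LocalThreeTorsionAdicCompletion`), `hq`/`hv`
(`#Ш_an`), `hr` / the class atoms. Census reach (x11a REPORT-g12, N < 5·10⁵, p ≥ 5): 108 of the 158
surjective-leaf pairs with `p ∣ #Ш_an` have a visible rank-2 partner (95 in Cremona's table, 13 in
Fisher's Hesse pencils); 4 pairs have no partner for any engine (206856cb1@17, 244068m1@11,
429975cr1@13, 285660k1@5).

References: [CremonaMazur2000] §3 and Table 1; [AgasheStein2002] Thm. 3.1; [Wuthrich2014] Prop. 21;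
[SilvermanAEC2009] X.4.14, VII.5.1; [SilvermanATAEC1994] V.3.1, V.5.3, V.5.4; [Miller2011LMS]
Def. 1.1; [Mazur1977] III.§5; HOME `run/shared/lean/pub/bsd-print-x11a/P4-VISIBILITY-ROAD.md`.
-/

set_option autoImplicit false

noncomputable section

open scoped Classical

open WeierstrassCurve Literature.NumberTheory.EllipticCurves
  Literature.NumberTheory.EllipticCurves.Rank1Residual
  Literature.NumberTheory.EllipticCurves.Rank1Residual.Typed
  Literature.NumberTheory.EllipticCurves.Wuthrich2014
  NumberField IsDedekindDomain Rat.HeightOneSpectrum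

namespace Summit.BirchSwinnertonDyer.Rank1Residual.X11a

variable {W : WeierstrassCurve ℚ} [W.IsElliptic] [W.IsGloballyMinimal] {p : ℕ} [Fact p.Prime]

/-! ### §1 The lower half `MissingLowerBoundAt W p` at an X11a pair from a visible rank-2 partner -/

/-- **X11a, per pair: the LOWER half from a visible rank-2 partner (crude count).** At an X11a pair
`(E, p)` (`E = W`; `r_an = 0`, `p` odd, `p ∥ N`, `E[p]` irreducible, no (ram) prime) with
`#Ш(E/ℚ)_an = q`, `ord_p q ≤ 2`, a `Γ_ℚ`-equivariant `θ : E'[p] ≃ E[p]` from an elliptic curve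
`E' = W'` with `rank E'(ℚ) ≥ 2`, and a finite set `S` of places (outside: both curves good, `v ∤ p`)
with `E'(ℚ_v)[p] = 0` on `S`, one has `ord_p #Ш(E/ℚ)_an ≤ ord_p #Ш(E/ℚ)` — the conclusion of the
ladder's crux `X11aLowerHalf` AT THIS PAIR. Visibility (`exists_sha_ne_zero_of_congr_of_rank`, no
condition at `p`) + Cassels–Tate squareness (`hCT`) + GZK finiteness (`hGZK`); by name the class-free
socket `Additive.RankZero.missingLowerBoundAt_of_congr_of_rank_two`. No image hypothesis beyond the
class's irreducibility. PER PAIR; not a class theorem. [cite: CremonaMazur2000, §3 and Table 1]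
[cite: AgasheStein2002, Thm. 3.1] [cite: SilvermanAEC2009, Thm. X.4.14]
[cite: Miller2011LMS, Def. 1.1 (arXiv:1010.2431 p. 3)] -/
theorem _root_.Summit.BirchSwinnertonDyer.Rank1Residual.ClassX11a.missingLowerBoundAt_of_congr_of_rank_two
    (hCT : exists_casselsTate_pairing (K := ℚ))
    (hGZK : rank_eq_analyticRank_of_analyticRank_le_one) (hX : ClassX11a W p)
    {q : ℚ} (hq : shaAn W = (q : ℂ)) (hv : padicValRat p q ≤ 2)
    (W' : WeierstrassCurve ℚ) [W'.IsElliptic]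
    (θ : geomTorsion W' (p : ℤ) ≃+ geomTorsion W (p : ℤ))
    (hθ : ∀ (σ : Field.absoluteGaloisGroup ℚ) (P : geomTorsion W' (p : ℤ)), θ (σ • P) = σ • θ P)
    (hrank : 2 ≤ W'.mordellWeilRank) (S : Finset (HeightOneSpectrum (𝓞 ℚ)))
    (hS : ∀ v : HeightOneSpectrum (𝓞 ℚ), v ∉ S →
      W.HasGoodReductionAt v ∧ W'.HasGoodReductionAt v ∧ (p : 𝓞 ℚ) ∉ v.asIdeal)
    (hloc : ∀ v ∈ S, Nat.card (nsmulAddMonoidHom p :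
      (W'.baseChange (v.adicCompletion ℚ)).toAffine.Point →+ _).ker = 1) :
    MissingLowerBoundAt W p :=
  Additive.RankZero.missingLowerBoundAt_of_congr_of_rank_two W p hCT hGZK hX.ne_two hX.1 hX.irr hq
    hv W' θ hθ hrank S hS hloc

/-- **X11a, per pair: the LOWER half from a visible rank-2 partner, prime-list form** — `S` = the
places over a list `L ∋ p` of primes containing every prime divisor of the discriminants of integer
models `E₀`, `F₀` of `E`, `E'` (Silverman *AEC* VII.5.1 (a): good reduction off `L`), the local binder
asked exactly at the places over `L`. By name `Additive.RankZero.missingLowerBoundAt_of_congr_of_rank_two_of_primeList`.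
PER PAIR; not a class theorem. [cite: SilvermanAEC2009, VII.5 Prop. 5.1(a)]
[cite: CremonaMazur2000, §3 and Table 1] [cite: Miller2011LMS, Def. 1.1 (arXiv:1010.2431 p. 3)] -/
theorem _root_.Summit.BirchSwinnertonDyer.Rank1Residual.ClassX11a.missingLowerBoundAt_of_congr_of_rank_two_of_primeList
    (hCT : exists_casselsTate_pairing (K := ℚ))
    (hGZK : rank_eq_analyticRank_of_analyticRank_le_one) (hX : ClassX11a W p)
    {q : ℚ} (hq : shaAn W = (q : ℂ)) (hv : padicValRat p q ≤ 2)
    (W' : WeierstrassCurve ℚ) [W'.IsElliptic]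
    (θ : geomTorsion W' (p : ℤ) ≃+ geomTorsion W (p : ℤ))
    (hθ : ∀ (σ : Field.absoluteGaloisGroup ℚ) (P : geomTorsion W' (p : ℤ)), θ (σ • P) = σ • θ P)
    (hrank : 2 ≤ W'.mordellWeilRank)
    {E₀ F₀ : WeierstrassCurve ℤ} (hE : E₀.map (Int.castRingHom ℚ) = W)
    (hF : F₀.map (Int.castRingHom ℚ) = W') (L : List ℕ) (hpL : p ∈ L)
    (hΔE : ∀ q : ℕ, q.Prime → (q : ℤ) ∣ E₀.Δ → q ∈ L)
    (hΔF : ∀ q : ℕ, q.Prime → (q : ℤ) ∣ F₀.Δ → q ∈ L)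
    (hloc : ∀ v : HeightOneSpectrum (𝓞 ℚ), (primesEquiv v : ℕ) ∈ L →
      Nat.card (nsmulAddMonoidHom p :
        (W'.baseChange (v.adicCompletion ℚ)).toAffine.Point →+ _).ker = 1) :
    MissingLowerBoundAt W p :=
  Additive.RankZero.missingLowerBoundAt_of_congr_of_rank_two_of_primeList W p hCT hGZK hX.ne_two hX.1
    hX.irr hq hv W' θ hθ hrank hE hF L hpL hΔE hΔF hloc

/-- **X11a leaf, per pair: the LOWER half from a visible rank-2 partner** (the leaf `Leaf W p` =
`ClassX11a ∧ 5 ≤ p ∧ ¬(Surj ∧ p ∤ #Ш_an)` — in particular on its NON-surjective part, images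
`5S4 / 5Ns / 7Ns`, where no published upper half exists and the typed input is Mazur's main
conjecture at the pair). PER PAIR; not a class theorem. [cite: CremonaMazur2000, §3 and Table 1]
[cite: SilvermanAEC2009, Thm. X.4.14] [cite: Miller2011LMS, Def. 1.1 (arXiv:1010.2431 p. 3)] -/
theorem Leaf.missingLowerBoundAt_of_congr_of_rank_two (hCT : exists_casselsTate_pairing (K := ℚ))
    (hGZK : rank_eq_analyticRank_of_analyticRank_le_one) (h : Leaf W p)
    {q : ℚ} (hq : shaAn W = (q : ℂ)) (hv : padicValRat p q ≤ 2)
    (W' : WeierstrassCurve ℚ) [W'.IsElliptic]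
    (θ : geomTorsion W' (p : ℤ) ≃+ geomTorsion W (p : ℤ))
    (hθ : ∀ (σ : Field.absoluteGaloisGroup ℚ) (P : geomTorsion W' (p : ℤ)), θ (σ • P) = σ • θ P)
    (hrank : 2 ≤ W'.mordellWeilRank) (S : Finset (HeightOneSpectrum (𝓞 ℚ)))
    (hS : ∀ v : HeightOneSpectrum (𝓞 ℚ), v ∉ S →
      W.HasGoodReductionAt v ∧ W'.HasGoodReductionAt v ∧ (p : 𝓞 ℚ) ∉ v.asIdeal)
    (hloc : ∀ v ∈ S, Nat.card (nsmulAddMonoidHom p :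
      (W'.baseChange (v.adicCompletion ℚ)).toAffine.Point →+ _).ker = 1) :
    MissingLowerBoundAt W p :=
  h.classX11a.missingLowerBoundAt_of_congr_of_rank_two hCT hGZK hq hv W' θ hθ hrank S hS hloc

/-! ### §2 `BSD(E,p)` on the surjective leaf from a visible rank-2 partner -/

/-- **X11a leaf ∧ `ρ̄_{E,p}` surjective, per pair: `BSD(E,p)` from a visible rank-2 partner** (on the
surjective leaf `p ∣ #Ш_an` is forced, `Leaf.not_shaAnUnit_of_surj`; the door needs
`ord_p #Ш_an ≤ 2`, i.e. `p² ∥ #Ш_an` — the shape of all 158 census pairs below `5·10⁵`). PER PAIR;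
not a class theorem. [cite: Wuthrich2014, Prop. 21 (p. 400)] [cite: CremonaMazur2000, §3 and Table 1]
[cite: SilvermanAEC2009, Thm. X.4.14] [cite: Miller2011LMS, §1 and Def. 1.1] -/
theorem Leaf.bsdp_of_congr_of_rank_two_of_surj
    (hCT : exists_casselsTate_pairing (K := ℚ)) (hW : sha_dvd_analyticSha)
    (hGZK : rank_eq_analyticRank_of_analyticRank_le_one) (hmod : hasEntireLFunction_rat)
    (h : Leaf W p) (hsurj : Surj W p)
    {q : ℚ} (hq : shaAn W = (q : ℂ)) (hv : padicValRat p q ≤ 2)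
    (W' : WeierstrassCurve ℚ) [W'.IsElliptic]
    (θ : geomTorsion W' (p : ℤ) ≃+ geomTorsion W (p : ℤ))
    (hθ : ∀ (σ : Field.absoluteGaloisGroup ℚ) (P : geomTorsion W' (p : ℤ)), θ (σ • P) = σ • θ P)
    (hrank : 2 ≤ W'.mordellWeilRank) (S : Finset (HeightOneSpectrum (𝓞 ℚ)))
    (hS : ∀ v : HeightOneSpectrum (𝓞 ℚ), v ∉ S →
      W.HasGoodReductionAt v ∧ W'.HasGoodReductionAt v ∧ (p : 𝓞 ℚ) ∉ v.asIdeal)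
    (hloc : ∀ v ∈ S, Nat.card (nsmulAddMonoidHom p :
      (W'.baseChange (v.adicCompletion ℚ)).toAffine.Point →+ _).ker = 1) :
    BSDp W p :=
  bsdp_of_congr_of_rank_two hCT hW hGZK hmod h.classX11a hsurj hq hv W' θ hθ hrank S hS hloc

/-- **X11a ∧ `ρ̄_{E,p}` surjective ∧ `ord_p #Ш_an ≤ 2`, per pair: `BSD(E,p)` from a visible partner —
REFINED count** (pay at the places of `T ⊆ S`, every other place of `S` of a free kind: (i) `v ∤ p`
with `E'(ℚ_v)[p] = 0`; (ii) both curves split multiplicative at `v` with `#E(ℚ_v)[p] ≤ p` — e.g. the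
place `p` itself for a same-conductor partner at a split `p`; (iii) both multiplicative with
`γ(E) = r² γ(E')` in `ℚ_v` and `μ_p(ℚ_v) = 1` — the place `p` for a same-conductor partner at a
non-split `p`, `p ≥ 5`). Conditional on Tate's uniformisation (`hU`, `hU2`); non-additivity at `p`
from the class's `Mult`. By name `Typed.bsdp_of_wuthrich_of_congr_of_places_of_surj` (x11a gen 10).
PER PAIR; not a class theorem. [cite: Wuthrich2014, Prop. 21 (p. 400)]
[cite: CremonaMazur2000, §3 and Table 1] [cite: AgasheStein2002, Thm. 3.1 and §3.5]
[cite: SilvermanATAEC1994, Ch. V Thm. 3.1, Lemma 5.2, Thm. 5.3, Cor. 5.4]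
[cite: SilvermanAEC2009, Thm. X.4.14] [cite: Miller2011LMS, §1 and Def. 1.1] -/
theorem _root_.Summit.BirchSwinnertonDyer.Rank1Residual.ClassX11a.bsdp_of_congr_of_places_of_surj
    (hCT : exists_casselsTate_pairing (K := ℚ)) (hW : sha_dvd_analyticSha)
    (hGZK : rank_eq_analyticRank_of_analyticRank_le_one) (hmod : hasEntireLFunction_rat)
    (hU : Silverman1994_thmV53_tateUniformisation.{0})
    (hU2 : Silverman1994_thmV53_corV54_tateUniformisation.{0})
    (hX : ClassX11a W p) (hsurj : Surj W p)
    {q : ℚ} (hq : shaAn W = (q : ℂ)) (hv : padicValRat p q ≤ 2)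
    (W' : WeierstrassCurve ℚ) [W'.IsElliptic]
    (θ : geomTorsion W' (p : ℤ) ≃+ geomTorsion W (p : ℤ))
    (hθ : ∀ (σ : Field.absoluteGaloisGroup ℚ) (P : geomTorsion W' (p : ℤ)), θ (σ • P) = σ • θ P)
    (S T : Finset (HeightOneSpectrum (𝓞 ℚ))) (hTS : T ⊆ S)
    (hS : ∀ v : HeightOneSpectrum (𝓞 ℚ), v ∉ S →
      W.HasGoodReductionAt v ∧ W'.HasGoodReductionAt v ∧ (p : 𝓞 ℚ) ∉ v.asIdeal)
    (hT : (∏ v ∈ T, Nat.card (nsmulAddMonoidHom p :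
        (W'.baseChange (v.adicCompletion ℚ)).toAffine.Point →+ _).ker *
        Nat.card (v.adicCompletionIntegers ℚ ⧸
          Ideal.span {(p : v.adicCompletionIntegers ℚ)})) < p ^ W'.mordellWeilRank)
    (hplaces : ∀ v ∈ S, v ∉ T →
      ((p : 𝓞 ℚ) ∉ v.asIdeal ∧ Nat.card (nsmulAddMonoidHom p :
          (W'.baseChange (v.adicCompletion ℚ)).toAffine.Point →+ _).ker = 1) ∨
      (W.HasSplitMultiplicativeReductionAt v ∧ W'.HasSplitMultiplicativeReductionAt v ∧
        Nat.card (nsmulAddMonoidHom p :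
          (W.baseChange (v.adicCompletion ℚ)).toAffine.Point →+ _).ker ≤ p) ∨
      (W.HasMultiplicativeReductionAt v ∧ W'.HasMultiplicativeReductionAt v ∧
        (∃ r : v.adicCompletion ℚ, algebraMap ℚ (v.adicCompletion ℚ) (-(W.c₄ / W.c₆)) =
          r ^ 2 * algebraMap ℚ (v.adicCompletion ℚ) (-(W'.c₄ / W'.c₆))) ∧
        (∀ ζ : v.adicCompletion ℚ, ζ ^ p = 1 → ζ = 1))) :
    BSDp W p :=
  bsdp_of_wuthrich_of_congr_of_places_of_surj W p hCT hW hGZK hmod hU hU2 hX.ne_two hX.1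
    (WeierstrassCurve.HasMultiplicativeReduction.not_hasAdditiveReduction (R := ℤ_[p]) hX.mult)
    hsurj hq hv W' θ hθ S T hTS hS hT hplaces

/-- **X11a ∧ `ρ̄_{E,p}` surjective, per pair: `BSD(E,p)` from a visible rank-2 partner, prime-list
form** — the record shape: `S` = the places over `L ∋ p` ⊇ the prime supports of both integral
discriminants, local binder asked at the places over `L`; the lower half of §1 closed by the cell's
discharge interface `ClassX11a.bsdp_of_missingLowerBoundAt_of_surj` (Wuthrich's upper half `hW`,
modularity `hmod`). PER PAIR; not a class theorem. [cite: Wuthrich2014, Prop. 21 (p. 400)]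
[cite: CremonaMazur2000, §3 and Table 1] [cite: SilvermanAEC2009, VII.5 Prop. 5.1(a)]
[cite: Miller2011LMS, §1 and Def. 1.1] -/
theorem _root_.Summit.BirchSwinnertonDyer.Rank1Residual.ClassX11a.bsdp_of_congr_of_rank_two_of_primeList_of_surj
    (hCT : exists_casselsTate_pairing (K := ℚ)) (hW : sha_dvd_analyticSha)
    (hGZK : rank_eq_analyticRank_of_analyticRank_le_one) (hmod : hasEntireLFunction_rat)
    (hX : ClassX11a W p) (hsurj : Surj W p)
    {q : ℚ} (hq : shaAn W = (q : ℂ)) (hv : padicValRat p q ≤ 2)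
    (W' : WeierstrassCurve ℚ) [W'.IsElliptic]
    (θ : geomTorsion W' (p : ℤ) ≃+ geomTorsion W (p : ℤ))
    (hθ : ∀ (σ : Field.absoluteGaloisGroup ℚ) (P : geomTorsion W' (p : ℤ)), θ (σ • P) = σ • θ P)
    (hrank : 2 ≤ W'.mordellWeilRank)
    {E₀ F₀ : WeierstrassCurve ℤ} (hE : E₀.map (Int.castRingHom ℚ) = W)
    (hF : F₀.map (Int.castRingHom ℚ) = W') (L : List ℕ) (hpL : p ∈ L)
    (hΔE : ∀ q : ℕ, q.Prime → (q : ℤ) ∣ E₀.Δ → q ∈ L)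
    (hΔF : ∀ q : ℕ, q.Prime → (q : ℤ) ∣ F₀.Δ → q ∈ L)
    (hloc : ∀ v : HeightOneSpectrum (𝓞 ℚ), (primesEquiv v : ℕ) ∈ L →
      Nat.card (nsmulAddMonoidHom p :
        (W'.baseChange (v.adicCompletion ℚ)).toAffine.Point →+ _).ker = 1) :
    BSDp W p :=
  hX.bsdp_of_missingLowerBoundAt_of_surj hW hGZK hmod hsurj
    (hX.missingLowerBoundAt_of_congr_of_rank_two_of_primeList hCT hGZK hq hv W' θ hθ hrank hE hF L
      hpL hΔE hΔF hloc)

end Summit.BirchSwinnertonDyer.Rank1Residual.X11a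

end
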